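import Mathlib.Analysis.SpecialFunctions.Pow.Real
import HarnessLib

/-!
# The set-split inequality (R) for a single hub: a Bernstein certificate

builds on p205010 (kernel theorem, internal audit signed; external expert review pending)

PAPER-2 track "percolation constants", part (ii), seat `prim-consts-1`, gen 25 (lane index `run/shared/lean/prim/consts/CONSTANTS.md`, row A19;
memo `FROM-prim-consts-1-g25-SET-SPLIT.md` §2).  Support file for the crux `NoHeavyLowerTail` (stmt-CriticalPhenomena-4575; `--supports`).
Theorems only (real polynomial identities and inequalities); no sorries, standard axioms, default heartbeats.

The four-point set-split inequality (R) `μ(ab↮cd)·μ(ac↮bd)·μ(ad↮bc) ≤ μ(a↮bcd)·μ(b↮acd)·μ(c↮abd)·μ(d↮abc)` (which implies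
`Consts.FourPointSplit` (ED): `Consts.fourPointSplit_of_setSplit`, `…ConstsFourPointSetSplit.lean`; the converse holds by terminal sums)
FACTORISES over the hubs of a graph whose interior is an independent set (every interior vertex `h` joined only to the terminals
`a,b,c,d`, with probabilities `α,β,γ,δ`): each of the seven events is the intersection over the hubs of an event read off the four pairs at
that hub, and these are independent.  Per hub, with `u = 1−α, v = 1−β, w = 1−γ, z = 1−δ` and `Q = uvwz`:
`P(h does not join {a,b} to {c,d}) = uv + wz − Q` and `P(h does not join a to another terminal) = u + vwz − Q`; so (R) for hub graphs
is the four-variable polynomial inequality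
  (APEX)  `(uv + wz − Q)(uw + vz − Q)(uz + vw − Q) ≤ (u + vwz − Q)(v + uwz − Q)(w + uvz − Q)(z + uvw − Q)` on `[0,1]⁴`.
* `Consts.apex_setSplit_identity` — `RHS − LHS = uvwz · G` with `G` written in the tensor Bernstein basis of multidegree `(3,3,3,3)`:
  81 nonzero coefficients, ALL POSITIVE (found by exact rational arithmetic this gen; checked here by `ring`).
* `Consts.apex_setSplit` — **(APEX) holds (kernel)**, by the identity and `positivity`.  Equality iff `uvwz = 0` or `u=v=w=z=1`; near
  `u=v=w=z=1` the slack is `5αβγδ` to fourth order; if one of `α,β,γ,δ` vanishes (a hub of degree `≤ 3`) the two sides agree identically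
  (`Consts.apex_setSplit_eq_of_deg_three`) — the equality class of (R) contains every weighted `K₄` with pendant hubs of degree `≤ 3`.
The three-point analogue `x² ≤ D_a D_b D_c` (isolating TS) already FAILS for one hub (the 3-star, third order): `Consts.not_isolatingTripleSplit`.
References: N. Gladkov, A. Zimin, arXiv:2404.08873 (2024), Thm. 3.2 (bond percolation cannot simulate a 4-hyperedge — the site law
violating (R)); G. Grimmett, *Percolation* (1999), §2.2.
-/

namespace Summit.CriticalPhenomena.PercolationContinuityZ3.Theorems

namespace Consts

/-- **The Bernstein certificate for (APEX)**: `RHS − LHS = uvwz · Σ_I c_I · Π_x x^{I_x} (1−x)^{3−I_x}` with the 81 positive rational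
coefficients `c_I` displayed (tensor Bernstein basis of multidegree `(3,3,3,3)`, binomial factors absorbed). [derived here] -/
theorem apex_setSplit_identity (u v w z : ℝ) :
    (u + v * w * z - u * v * w * z) * (v + u * w * z - u * v * w * z) * (w + u * v * z - u * v * w * z) *
        (z + u * v * w - u * v * w * z) -
      (u * v + w * z - u * v * w * z) * (u * w + v * z - u * v * w * z) * (u * z + v * w - u * v * w * z) =
      u * v * w * z * (
      ((1 - u) * (1 - u) * (1 - u) * (1 - v) * (1 - v) * (1 - v) * (1 - w) * (1 - w) * (1 - w) * (1 - z) * (1 - z) * (1 - z) +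
        (3 : ℝ) * (1 - u) * (1 - u) * (1 - u) * (1 - v) * (1 - v) * (1 - v) * (1 - w) * (1 - w) * (1 - w) * z * (1 - z) * (1 - z) +
        (2 : ℝ) * (1 - u) * (1 - u) * (1 - u) * (1 - v) * (1 - v) * (1 - v) * (1 - w) * (1 - w) * (1 - w) * z * z * (1 - z) +
        (3 : ℝ) * (1 - u) * (1 - u) * (1 - u) * (1 - v) * (1 - v) * (1 - v) * w * (1 - w) * (1 - w) * (1 - z) * (1 - z) * (1 - z) +
        (9 : ℝ) * (1 - u) * (1 - u) * (1 - u) * (1 - v) * (1 - v) * (1 - v) * w * (1 - w) * (1 - w) * z * (1 - z) * (1 - z) +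
        (6 : ℝ) * (1 - u) * (1 - u) * (1 - u) * (1 - v) * (1 - v) * (1 - v) * w * (1 - w) * (1 - w) * z * z * (1 - z) +
        (2 : ℝ) * (1 - u) * (1 - u) * (1 - u) * (1 - v) * (1 - v) * (1 - v) * w * w * (1 - w) * (1 - z) * (1 - z) * (1 - z) +
        (6 : ℝ) * (1 - u) * (1 - u) * (1 - u) * (1 - v) * (1 - v) * (1 - v) * w * w * (1 - w) * z * (1 - z) * (1 - z) +
        (4 : ℝ) * (1 - u) * (1 - u) * (1 - u) * (1 - v) * (1 - v) * (1 - v) * w * w * (1 - w) * z * z * (1 - z)) +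
      ((3 : ℝ) * (1 - u) * (1 - u) * (1 - u) * v * (1 - v) * (1 - v) * (1 - w) * (1 - w) * (1 - w) * (1 - z) * (1 - z) * (1 - z) +
        (9 : ℝ) * (1 - u) * (1 - u) * (1 - u) * v * (1 - v) * (1 - v) * (1 - w) * (1 - w) * (1 - w) * z * (1 - z) * (1 - z) +
        (6 : ℝ) * (1 - u) * (1 - u) * (1 - u) * v * (1 - v) * (1 - v) * (1 - w) * (1 - w) * (1 - w) * z * z * (1 - z) +
        (9 : ℝ) * (1 - u) * (1 - u) * (1 - u) * v * (1 - v) * (1 - v) * w * (1 - w) * (1 - w) * (1 - z) * (1 - z) * (1 - z) +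
        (26 : ℝ) * (1 - u) * (1 - u) * (1 - u) * v * (1 - v) * (1 - v) * w * (1 - w) * (1 - w) * z * (1 - z) * (1 - z) +
        (17 : ℝ) * (1 - u) * (1 - u) * (1 - u) * v * (1 - v) * (1 - v) * w * (1 - w) * (1 - w) * z * z * (1 - z) +
        (6 : ℝ) * (1 - u) * (1 - u) * (1 - u) * v * (1 - v) * (1 - v) * w * w * (1 - w) * (1 - z) * (1 - z) * (1 - z) +
        (17 : ℝ) * (1 - u) * (1 - u) * (1 - u) * v * (1 - v) * (1 - v) * w * w * (1 - w) * z * (1 - z) * (1 - z) +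
        (11 : ℝ) * (1 - u) * (1 - u) * (1 - u) * v * (1 - v) * (1 - v) * w * w * (1 - w) * z * z * (1 - z)) +
      ((2 : ℝ) * (1 - u) * (1 - u) * (1 - u) * v * v * (1 - v) * (1 - w) * (1 - w) * (1 - w) * (1 - z) * (1 - z) * (1 - z) +
        (6 : ℝ) * (1 - u) * (1 - u) * (1 - u) * v * v * (1 - v) * (1 - w) * (1 - w) * (1 - w) * z * (1 - z) * (1 - z) +
        (4 : ℝ) * (1 - u) * (1 - u) * (1 - u) * v * v * (1 - v) * (1 - w) * (1 - w) * (1 - w) * z * z * (1 - z) +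
        (6 : ℝ) * (1 - u) * (1 - u) * (1 - u) * v * v * (1 - v) * w * (1 - w) * (1 - w) * (1 - z) * (1 - z) * (1 - z) +
        (17 : ℝ) * (1 - u) * (1 - u) * (1 - u) * v * v * (1 - v) * w * (1 - w) * (1 - w) * z * (1 - z) * (1 - z) +
        (11 : ℝ) * (1 - u) * (1 - u) * (1 - u) * v * v * (1 - v) * w * (1 - w) * (1 - w) * z * z * (1 - z) +
        (4 : ℝ) * (1 - u) * (1 - u) * (1 - u) * v * v * (1 - v) * w * w * (1 - w) * (1 - z) * (1 - z) * (1 - z) +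
        (11 : ℝ) * (1 - u) * (1 - u) * (1 - u) * v * v * (1 - v) * w * w * (1 - w) * z * (1 - z) * (1 - z) +
        (7 : ℝ) * (1 - u) * (1 - u) * (1 - u) * v * v * (1 - v) * w * w * (1 - w) * z * z * (1 - z)) +
      ((3 : ℝ) * u * (1 - u) * (1 - u) * (1 - v) * (1 - v) * (1 - v) * (1 - w) * (1 - w) * (1 - w) * (1 - z) * (1 - z) * (1 - z) +
        (9 : ℝ) * u * (1 - u) * (1 - u) * (1 - v) * (1 - v) * (1 - v) * (1 - w) * (1 - w) * (1 - w) * z * (1 - z) * (1 - z) +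
        (6 : ℝ) * u * (1 - u) * (1 - u) * (1 - v) * (1 - v) * (1 - v) * (1 - w) * (1 - w) * (1 - w) * z * z * (1 - z) +
        (9 : ℝ) * u * (1 - u) * (1 - u) * (1 - v) * (1 - v) * (1 - v) * w * (1 - w) * (1 - w) * (1 - z) * (1 - z) * (1 - z) +
        (26 : ℝ) * u * (1 - u) * (1 - u) * (1 - v) * (1 - v) * (1 - v) * w * (1 - w) * (1 - w) * z * (1 - z) * (1 - z) +
        (17 : ℝ) * u * (1 - u) * (1 - u) * (1 - v) * (1 - v) * (1 - v) * w * (1 - w) * (1 - w) * z * z * (1 - z) +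
        (6 : ℝ) * u * (1 - u) * (1 - u) * (1 - v) * (1 - v) * (1 - v) * w * w * (1 - w) * (1 - z) * (1 - z) * (1 - z) +
        (17 : ℝ) * u * (1 - u) * (1 - u) * (1 - v) * (1 - v) * (1 - v) * w * w * (1 - w) * z * (1 - z) * (1 - z) +
        (11 : ℝ) * u * (1 - u) * (1 - u) * (1 - v) * (1 - v) * (1 - v) * w * w * (1 - w) * z * z * (1 - z)) +
      ((9 : ℝ) * u * (1 - u) * (1 - u) * v * (1 - v) * (1 - v) * (1 - w) * (1 - w) * (1 - w) * (1 - z) * (1 - z) * (1 - z) +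
        (26 : ℝ) * u * (1 - u) * (1 - u) * v * (1 - v) * (1 - v) * (1 - w) * (1 - w) * (1 - w) * z * (1 - z) * (1 - z) +
        (17 : ℝ) * u * (1 - u) * (1 - u) * v * (1 - v) * (1 - v) * (1 - w) * (1 - w) * (1 - w) * z * z * (1 - z) +
        (26 : ℝ) * u * (1 - u) * (1 - u) * v * (1 - v) * (1 - v) * w * (1 - w) * (1 - w) * (1 - z) * (1 - z) * (1 - z) +
        (69 : ℝ) * u * (1 - u) * (1 - u) * v * (1 - v) * (1 - v) * w * (1 - w) * (1 - w) * z * (1 - z) * (1 - z) +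
        (42 : ℝ) * u * (1 - u) * (1 - u) * v * (1 - v) * (1 - v) * w * (1 - w) * (1 - w) * z * z * (1 - z) +
        (17 : ℝ) * u * (1 - u) * (1 - u) * v * (1 - v) * (1 - v) * w * w * (1 - w) * (1 - z) * (1 - z) * (1 - z) +
        (42 : ℝ) * u * (1 - u) * (1 - u) * v * (1 - v) * (1 - v) * w * w * (1 - w) * z * (1 - z) * (1 - z) +
        (24 : ℝ) * u * (1 - u) * (1 - u) * v * (1 - v) * (1 - v) * w * w * (1 - w) * z * z * (1 - z)) +
      ((6 : ℝ) * u * (1 - u) * (1 - u) * v * v * (1 - v) * (1 - w) * (1 - w) * (1 - w) * (1 - z) * (1 - z) * (1 - z) +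
        (17 : ℝ) * u * (1 - u) * (1 - u) * v * v * (1 - v) * (1 - w) * (1 - w) * (1 - w) * z * (1 - z) * (1 - z) +
        (11 : ℝ) * u * (1 - u) * (1 - u) * v * v * (1 - v) * (1 - w) * (1 - w) * (1 - w) * z * z * (1 - z) +
        (17 : ℝ) * u * (1 - u) * (1 - u) * v * v * (1 - v) * w * (1 - w) * (1 - w) * (1 - z) * (1 - z) * (1 - z) +
        (42 : ℝ) * u * (1 - u) * (1 - u) * v * v * (1 - v) * w * (1 - w) * (1 - w) * z * (1 - z) * (1 - z) +
        (24 : ℝ) * u * (1 - u) * (1 - u) * v * v * (1 - v) * w * (1 - w) * (1 - w) * z * z * (1 - z) +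
        (11 : ℝ) * u * (1 - u) * (1 - u) * v * v * (1 - v) * w * w * (1 - w) * (1 - z) * (1 - z) * (1 - z) +
        (24 : ℝ) * u * (1 - u) * (1 - u) * v * v * (1 - v) * w * w * (1 - w) * z * (1 - z) * (1 - z) +
        (12 : ℝ) * u * (1 - u) * (1 - u) * v * v * (1 - v) * w * w * (1 - w) * z * z * (1 - z)) +
      ((2 : ℝ) * u * u * (1 - u) * (1 - v) * (1 - v) * (1 - v) * (1 - w) * (1 - w) * (1 - w) * (1 - z) * (1 - z) * (1 - z) +
        (6 : ℝ) * u * u * (1 - u) * (1 - v) * (1 - v) * (1 - v) * (1 - w) * (1 - w) * (1 - w) * z * (1 - z) * (1 - z) +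
        (4 : ℝ) * u * u * (1 - u) * (1 - v) * (1 - v) * (1 - v) * (1 - w) * (1 - w) * (1 - w) * z * z * (1 - z) +
        (6 : ℝ) * u * u * (1 - u) * (1 - v) * (1 - v) * (1 - v) * w * (1 - w) * (1 - w) * (1 - z) * (1 - z) * (1 - z) +
        (17 : ℝ) * u * u * (1 - u) * (1 - v) * (1 - v) * (1 - v) * w * (1 - w) * (1 - w) * z * (1 - z) * (1 - z) +
        (11 : ℝ) * u * u * (1 - u) * (1 - v) * (1 - v) * (1 - v) * w * (1 - w) * (1 - w) * z * z * (1 - z) +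
        (4 : ℝ) * u * u * (1 - u) * (1 - v) * (1 - v) * (1 - v) * w * w * (1 - w) * (1 - z) * (1 - z) * (1 - z) +
        (11 : ℝ) * u * u * (1 - u) * (1 - v) * (1 - v) * (1 - v) * w * w * (1 - w) * z * (1 - z) * (1 - z) +
        (7 : ℝ) * u * u * (1 - u) * (1 - v) * (1 - v) * (1 - v) * w * w * (1 - w) * z * z * (1 - z)) +
      ((6 : ℝ) * u * u * (1 - u) * v * (1 - v) * (1 - v) * (1 - w) * (1 - w) * (1 - w) * (1 - z) * (1 - z) * (1 - z) +
        (17 : ℝ) * u * u * (1 - u) * v * (1 - v) * (1 - v) * (1 - w) * (1 - w) * (1 - w) * z * (1 - z) * (1 - z) +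
        (11 : ℝ) * u * u * (1 - u) * v * (1 - v) * (1 - v) * (1 - w) * (1 - w) * (1 - w) * z * z * (1 - z) +
        (17 : ℝ) * u * u * (1 - u) * v * (1 - v) * (1 - v) * w * (1 - w) * (1 - w) * (1 - z) * (1 - z) * (1 - z) +
        (42 : ℝ) * u * u * (1 - u) * v * (1 - v) * (1 - v) * w * (1 - w) * (1 - w) * z * (1 - z) * (1 - z) +
        (24 : ℝ) * u * u * (1 - u) * v * (1 - v) * (1 - v) * w * (1 - w) * (1 - w) * z * z * (1 - z) +
        (11 : ℝ) * u * u * (1 - u) * v * (1 - v) * (1 - v) * w * w * (1 - w) * (1 - z) * (1 - z) * (1 - z) +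
        (24 : ℝ) * u * u * (1 - u) * v * (1 - v) * (1 - v) * w * w * (1 - w) * z * (1 - z) * (1 - z) +
        (12 : ℝ) * u * u * (1 - u) * v * (1 - v) * (1 - v) * w * w * (1 - w) * z * z * (1 - z)) +
      ((4 : ℝ) * u * u * (1 - u) * v * v * (1 - v) * (1 - w) * (1 - w) * (1 - w) * (1 - z) * (1 - z) * (1 - z) +
        (11 : ℝ) * u * u * (1 - u) * v * v * (1 - v) * (1 - w) * (1 - w) * (1 - w) * z * (1 - z) * (1 - z) +
        (7 : ℝ) * u * u * (1 - u) * v * v * (1 - v) * (1 - w) * (1 - w) * (1 - w) * z * z * (1 - z) +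
        (11 : ℝ) * u * u * (1 - u) * v * v * (1 - v) * w * (1 - w) * (1 - w) * (1 - z) * (1 - z) * (1 - z) +
        (24 : ℝ) * u * u * (1 - u) * v * v * (1 - v) * w * (1 - w) * (1 - w) * z * (1 - z) * (1 - z) +
        (12 : ℝ) * u * u * (1 - u) * v * v * (1 - v) * w * (1 - w) * (1 - w) * z * z * (1 - z) +
        (7 : ℝ) * u * u * (1 - u) * v * v * (1 - v) * w * w * (1 - w) * (1 - z) * (1 - z) * (1 - z) +
        (12 : ℝ) * u * u * (1 - u) * v * v * (1 - v) * w * w * (1 - w) * z * (1 - z) * (1 - z) +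
        (5 : ℝ) * u * u * (1 - u) * v * v * (1 - v) * w * w * (1 - w) * z * z * (1 - z))) := by
  ring

/-- **(APEX) — the set-split inequality (R) for one hub.**  For `u v w z ∈ [0,1]`:
`(uv + wz − uvwz)(uw + vz − uvwz)(uz + vw − uvwz) ≤ (u + vwz − uvwz)(v + uwz − uvwz)(w + uvz − uvwz)(z + uvw − uvwz)`.
[derived here] -/
theorem apex_setSplit {u v w z : ℝ} (hu : 0 ≤ u) (hu1 : u ≤ 1) (hv : 0 ≤ v) (hv1 : v ≤ 1) (hw : 0 ≤ w) (hw1 : w ≤ 1)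
    (hz : 0 ≤ z) (hz1 : z ≤ 1) :
    (u * v + w * z - u * v * w * z) * (u * w + v * z - u * v * w * z) * (u * z + v * w - u * v * w * z) ≤
      (u + v * w * z - u * v * w * z) * (v + u * w * z - u * v * w * z) * (w + u * v * z - u * v * w * z) *
        (z + u * v * w - u * v * w * z) := by
  have ha : 0 ≤ 1 - u := by linarith
  have hb : 0 ≤ 1 - v := by linarith
  have hc : 0 ≤ 1 - w := by linarith
  have hd : 0 ≤ 1 - z := by linarith
  rw [← sub_nonneg, apex_setSplit_identity]
  positivity

/-- **Equality for a hub of degree three**: at `u = 1` (the hub is never joined to `a`) the two sides of (APEX) coincide. [derived here] -/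
theorem apex_setSplit_eq_of_deg_three (v w z : ℝ) :
    ((1 : ℝ) * v + w * z - 1 * v * w * z) * (1 * w + v * z - 1 * v * w * z) * (1 * z + v * w - 1 * v * w * z) =
      (1 + v * w * z - 1 * v * w * z) * (v + 1 * w * z - 1 * v * w * z) * (w + 1 * v * z - 1 * v * w * z) *
        (z + 1 * v * w - 1 * v * w * z) := by
  ring

end Consts

end Summit.CriticalPhenomena.PercolationContinuityZ3.Theorems
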